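import Mathlib

/-!
# Crux `ExactCertificate` (stmt-AtomisticToContinuum-11959), line `closure-makes-nogap-exact`,
# skeleton VIII (`InvisibilityDichotomy`): stub `stub_jensenCount`

Support file for the crux `ThreeConeCertificate.ExactCertificate`, skeleton VIII
(`Cruxes.ExactCertificate.Invisibility.InvisibilityDichotomy`: no nonzero finite-range continuous
radial kernel on `ℝ³` has Fourier transform vanishing on a lattice minus `0`).  There the slice of
the Fourier transform is an entire function of exponential type vanishing at superlinearly many
lattice norms; this file proves the counting step that makes this impossible for a nonzero
function: an entire `Φ` with `‖Φ z‖ ≤ B e^{τ ‖z‖}` and `Φ c ≠ 0` admits constants `C₁, C₂`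
(depending on `Φ, B, τ, c` only) such that every finite set `Z` of zeros of `Φ` of norm `≤ R`
has `#Z ≤ C₂ R + C₁`.

Proof: Jensen's inequality `AnalyticOnNhd.sum_divisor_le` on `closedBall c r ⊆ closedBall c (2r)`,
`r := R + ‖c‖`, with the bound `M := max 1 (B e^{|τ| (‖c‖ + 2r)})` on the sphere of radius `2r`,
gives `∑ᶠ u, divisor Φ (closedBall c r) u ≤ log (M / ‖Φ c‖) / log 2`.  The divisor of the
analytic `Φ` is nonnegative, and `≥ 1` at every zero `z ∈ Z ⊆ closedBall c r` (the analytic order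
at `z` is neither `0` nor `⊤`, the latter by the identity theorem since `Φ c ≠ 0`), so the finsum
dominates `#Z`; finally `log M ≤ log (max 1 B) + |τ| (3‖c‖ + 2R)`, whence
`C₂ := 2|τ| / log 2`, `C₁ := (log (max 1 B) + 3|τ|‖c‖ − log ‖Φ c‖) / log 2`.  Pure Mathlib
(`AnalyticOnNhd.sum_divisor_le`, `MeromorphicOn.AnalyticOnNhd.divisor_apply`,
`analyticOrderAt_eq_top`,
`AnalyticOnNhd.eqOn_zero_of_preconnected_of_eventuallyEq_zero`, `Differentiable.analyticAt`,
`finsum_eq_sum_of_support_subset`); two private helpers; no named facts.  All `[folklore]`.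
-/

noncomputable section

namespace Summit.AtomisticToContinuum.Crystallization.Theorems.ThreeConeCertificateExactCertificate.Invisibility

open Set Filter Topology Metric

/-- The divisor of a nonzero entire function `Φ` (`Φ c ≠ 0`) on any set `U` is at least `1` at
every zero `z ∈ U` of `Φ`: the analytic order at `z` is a natural number (not `⊤`, by the identity
theorem) and is nonzero. [folklore] -/
private theorem one_le_divisor_of_zero {Φ : ℂ → ℂ} (hΦ : Differentiable ℂ Φ) {c : ℂ}
    (hc : Φ c ≠ 0) {U : Set ℂ} {z : ℂ} (hz : z ∈ U) (hΦz : Φ z = 0) :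
    1 ≤ MeromorphicOn.divisor Φ U z := by
  have h₁ : AnalyticOnNhd ℂ Φ U := fun w _ => hΦ.analyticAt w
  rw [MeromorphicOn.AnalyticOnNhd.divisor_apply h₁ hz]
  have htop : analyticOrderAt Φ z ≠ ⊤ := by
    intro h
    rw [analyticOrderAt_eq_top] at h
    have hall : AnalyticOnNhd ℂ Φ Set.univ := fun w _ => hΦ.analyticAt w
    exact hc (hall.eqOn_zero_of_preconnected_of_eventuallyEq_zero isPreconnected_univ
      (Set.mem_univ z) h (Set.mem_univ c))
  have hne : analyticOrderAt Φ z ≠ 0 := (hΦ.analyticAt z).analyticOrderAt_ne_zero.mpr hΦz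
  obtain ⟨n, hn⟩ := ENat.ne_top_iff_exists.mp htop
  rw [← hn] at hne ⊢
  have hn0 : n ≠ 0 := by exact_mod_cast hne
  rw [ENat.map_coe, WithTop.untop₀_coe]
  exact_mod_cast Nat.one_le_iff_ne_zero.mpr hn0

/-- For a nonzero entire `Φ` and a finite set `Z` of zeros of `Φ` inside `closedBall c |r|`, the
number of elements of `Z` is at most the total mass `∑ᶠ u, divisor Φ (closedBall c |r|) u` of the
(nonnegative, finitely supported) divisor. [folklore] -/
private theorem card_le_finsum_divisor {Φ : ℂ → ℂ} (hΦ : Differentiable ℂ Φ) {c : ℂ}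
    (hc : Φ c ≠ 0) {r : ℝ} (Z : Finset ℂ)
    (hZ : ∀ z ∈ Z, z ∈ closedBall c |r| ∧ Φ z = 0) :
    (Z.card : ℤ) ≤ ∑ᶠ u, MeromorphicOn.divisor Φ (closedBall c |r|) u := by
  classical
  set D := MeromorphicOn.divisor Φ (closedBall c |r|) with hD
  have h₁ : AnalyticOnNhd ℂ Φ (closedBall c |r|) := fun w _ => hΦ.analyticAt w
  have hfin : (Function.support D).Finite := D.finiteSupport (isCompact_closedBall c |r|)
  have hsub : Function.support D ⊆ ↑(hfin.toFinset ∪ Z) := by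
    intro u hu
    rw [Finset.coe_union]
    exact Or.inl (hfin.mem_toFinset.mpr hu)
  rw [finsum_eq_sum_of_support_subset D hsub]
  calc (Z.card : ℤ) = ∑ _u ∈ Z, (1 : ℤ) := by simp
    _ ≤ ∑ u ∈ Z, D u :=
      Finset.sum_le_sum fun u hu => one_le_divisor_of_zero hΦ hc (hZ u hu).1 (hZ u hu).2
    _ ≤ ∑ u ∈ hfin.toFinset ∪ Z, D u :=
      Finset.sum_le_sum_of_subset_of_nonneg Finset.subset_union_right
        fun u _ _ => MeromorphicOn.AnalyticOnNhd.divisor_nonneg h₁ u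

/-- **Jensen zero count.**  A nonzero entire function of exponential type has `O(R)` zeros in
the `R`-ball: if `Φ` is entire, `‖Φ z‖ ≤ B e^{τ ‖z‖}` and `Φ c ≠ 0`, there are constants `C₁ C₂`
such that every finite set `Z` of zeros of `Φ` of norm `≤ R` (`R > 0`) has `#Z ≤ C₂ R + C₁`
(Jensen's inequality `AnalyticOnNhd.sum_divisor_le` on `closedBall c (R + ‖c‖)` inside
`closedBall c (2 (R + ‖c‖))`). [folklore] -/
theorem stub_jensenCount : ∀ (Φ : ℂ → ℂ) (B τ : ℝ) (c : ℂ), Differentiable ℂ Φ →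
    (∀ z : ℂ, ‖Φ z‖ ≤ B * Real.exp (τ * ‖z‖)) → Φ c ≠ 0 →
    ∃ C₁ C₂ : ℝ, ∀ (R : ℝ) (Z : Finset ℂ), 0 < R → (∀ z ∈ Z, ‖z‖ ≤ R ∧ Φ z = 0) →
      (Z.card : ℝ) ≤ C₂ * R + C₁ := by
  intro Φ B τ c hΦ hB hc
  refine ⟨(Real.log (max 1 B) + 3 * |τ| * ‖c‖ - Real.log ‖Φ c‖) / Real.log 2,
    2 * |τ| / Real.log 2, ?_⟩
  intro R Z hR hZ
  -- the two radii `r < 2r`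
  set r : ℝ := R + ‖c‖ with hr_def
  have hr : 0 < r := by positivity
  have habs_r : |r| = r := abs_of_pos hr
  have habs_R' : |2 * r| = 2 * r := abs_of_pos (by positivity)
  have h₁f : AnalyticOnNhd ℂ Φ (closedBall c |2 * r|) := fun z _ => hΦ.analyticAt z
  -- `B ≥ 0` since `0 < ‖Φ c‖ ≤ B e^{τ ‖c‖}`
  have hΦc : 0 < ‖Φ c‖ := norm_pos_iff.mpr hc
  have hB0 : 0 ≤ B :=
    ((mul_pos_iff_of_pos_right (Real.exp_pos _)).mp (hΦc.trans_le (hB c))).le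
  -- the bound on the big sphere
  set M : ℝ := max 1 (B * Real.exp (|τ| * (‖c‖ + 2 * r))) with hM_def
  have hM : 1 ≤ M := le_max_left _ _
  have f_bound : ∀ z ∈ sphere c |2 * r|, ‖Φ z‖ ≤ M := by
    intro z hz
    rw [mem_sphere_iff_norm, habs_R'] at hz
    have hz' : ‖z‖ ≤ ‖c‖ + 2 * r :=
      calc ‖z‖ = ‖(z - c) + c‖ := by rw [sub_add_cancel]
        _ ≤ ‖z - c‖ + ‖c‖ := norm_add_le _ _
        _ = ‖c‖ + 2 * r := by rw [hz]; ring
    calc ‖Φ z‖ ≤ B * Real.exp (τ * ‖z‖) := hB z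
      _ ≤ B * Real.exp (|τ| * (‖c‖ + 2 * r)) := by
        refine mul_le_mul_of_nonneg_left (Real.exp_le_exp.mpr ?_) hB0
        calc τ * ‖z‖ ≤ |τ| * ‖z‖ := mul_le_mul_of_nonneg_right (le_abs_self τ) (norm_nonneg z)
          _ ≤ |τ| * (‖c‖ + 2 * r) := mul_le_mul_of_nonneg_left hz' (abs_nonneg τ)
      _ ≤ M := le_max_right _ _
  -- Jensen's inequality
  have jensen := AnalyticOnNhd.sum_divisor_le (c := c) (r := r) (R := 2 * r) (M := M) (f := Φ)
    (by rw [habs_r]; exact hr) (by rw [habs_r, habs_R']; linarith) hM h₁f hc f_bound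
  have hlog2 : (0 : ℝ) < Real.log 2 := Real.log_pos one_lt_two
  have hRr : 2 * r / r = 2 := by field_simp
  rw [hRr, Real.log_div (by positivity) hΦc.ne'] at jensen
  -- the zero count is dominated by the divisor mass
  have hcount : (Z.card : ℝ) ≤ ((∑ᶠ u, MeromorphicOn.divisor Φ (closedBall c |r|) u : ℤ) : ℝ) := by
    have key := card_le_finsum_divisor hΦ hc Z (r := r) fun z hz => ⟨?_, (hZ z hz).2⟩
    · exact_mod_cast key
    · rw [mem_closedBall_iff_norm, habs_r]
      calc ‖z - c‖ ≤ ‖z‖ + ‖c‖ := norm_sub_le _ _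
        _ ≤ R + ‖c‖ := by linarith [(hZ z hz).1]
  -- `log M ≤ log (max 1 B) + |τ| (‖c‖ + 2 r)`
  have hlogM : Real.log M ≤ Real.log (max 1 B) + |τ| * (‖c‖ + 2 * r) := by
    have hmax : 0 ≤ Real.log (max 1 B) := Real.log_nonneg (le_max_left _ _)
    have hexp : 0 ≤ |τ| * (‖c‖ + 2 * r) := by positivity
    rcases eq_or_lt_of_le hM with hM1 | hM1
    · rw [← hM1, Real.log_one]
      exact add_nonneg hmax hexp
    · have hX : 1 < B * Real.exp (|τ| * (‖c‖ + 2 * r)) := by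
        rcases lt_max_iff.mp hM1 with h | h
        · exact absurd h (lt_irrefl 1)
        · exact h
      have hMX : M = B * Real.exp (|τ| * (‖c‖ + 2 * r)) := by
        rw [hM_def]
        exact max_eq_right hX.le
      have hBpos : 0 < B :=
        (mul_pos_iff_of_pos_right (Real.exp_pos _)).mp (one_pos.trans hX)
      rw [hMX, Real.log_mul hBpos.ne' (Real.exp_pos _).ne', Real.log_exp]
      have := Real.log_le_log hBpos (le_max_right 1 B)
      linarith
  -- assemble
  have key : (Z.card : ℝ) ≤
      (Real.log (max 1 B) + |τ| * (‖c‖ + 2 * r) - Real.log ‖Φ c‖) / Real.log 2 :=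
    (hcount.trans jensen).trans (div_le_div_of_nonneg_right (by linarith) hlog2.le)
  have heq : (Real.log (max 1 B) + |τ| * (‖c‖ + 2 * r) - Real.log ‖Φ c‖) / Real.log 2 =
      2 * |τ| / Real.log 2 * R +
        (Real.log (max 1 B) + 3 * |τ| * ‖c‖ - Real.log ‖Φ c‖) / Real.log 2 := by
    rw [hr_def]
    field_simp
    ring
  exact key.trans_eq heq

end Summit.AtomisticToContinuum.Crystallization.Theorems.ThreeConeCertificateExactCertificate.Invisibility
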